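import Mathlib
import HarnessLib
import HarnessLib.Audit
import Summits.QuantumAdvantage.Statement
import Summits.QuantumAdvantage.AdviceFreeQNC0.AdviceFreeQNC0
import Summits.QuantumAdvantage.AdviceFreeQNC0.RingHardOdd
import Summits.QuantumAdvantage.AdviceFreeQNC0.AdviceFreeQNC0Three
import Summits.QuantumAdvantage.AdviceFreeQNC0.AffBells37PolyLoss
import Summits.QuantumAdvantage.AdviceFreeQNC0.BondTwistLocal
import Summits.QuantumAdvantage.QuantumAdvantage.Theorems.RingFrameBridge
import HarnessLib.Audit.Status.Attr

/-!
Route: PencilDial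

# Route PencilDial — Global pencils of every rank - the affine-in-register slice of ProductDial's
direct-product residual DPLift3, with the rank dial proved up to n registers (rung F-Q1-p3)

DECOMPOSITION CELL decomp-qadv (D-0178/D-0179), RESIDUAL MODE, node PencilDial (lens
decomp-qadv-lens-5 g4 «peel the multi-ring residual
by a strategy CLASS», NODE v1 2026-08-30T04:27:33Z sha256 f24ba136… = cleared file of record (1082
lines), v2 782be54d… = v1 + pure
additions §IV (1602 lines), lean check rc0 · 0 sorry · axioms standard 22/22; critic
decomp-qadv-crit-1 g2 row 22 CLEARED 04:34:49Z as
refines-child of ProductDial:26124). RUNG CURRENCY ONLY — nothing here bears on the root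
`QuantumAdvantage`. T = ProductDial's declared
residual DPLift3 (stmt-QuantumAdvantage-26124: PolyLoss3 → MultiRingHard3, the direct-product lift
from ONE ring with 1/poly loss to n^K
rings all won w.p. ≤ θ) — below T* = MultiRingHard3 < RingHardOdd 3. SHAPE B (sibling route;
ProductDial is at its 15-item cap): it
suffices to show X = GlobalPencilHard3 ∧ GlobalPencilLift3 — T* RESTRICTED to the class of GLOBAL
PENCILS of every rank R (joint
strategies whose ring-j outputs are A_i(X_j) + Σ_r (s_r + Σ_{j'≠j} γ_r(X_{j'}))·B_{r,i}(X_j): AFFINE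
in a shared 𝔽₃-register of foreign
polylog-degree features; crux r2, NECESSARY — T* ⟹ G PROVED `globalPencilHard3_of_multiRingHard3`;
OPEN beyond rank n; the rank dial
PROVED up to R ≤ n GIVEN 26123: `globalPencilHardUpTo_n` via `registerDP3`, filed as aside
GlobalPencilHardUpToN) and the lift GIVEN
its value on global pencils (crux r3, DECLARED RESIDUAL ≡ DPLift3 mod G:
`dpLift3_of_globalPencilLift3` / `globalPencilLift3_of_dpLift3`,
definitional currying). X → T is that currying; T → leaf is ProductDial's cone shared VERBATIM
(PolyLoss3 26123 open binder,
MultiRingBridge3 26125 PROVED in the ProductDial node). E_pres: the route states G in EVALUATED form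
over tree constants and the writer
sketch PROVES `GlobalPencilHard3 ↔ node.GlobalPencilHard3` (globalPencil_flat + pencil algebra),
likewise for Lift and the rung.
Lean: `PolyLoss3 → MultiRingHard3`

## Assembly
Inside `closes` (glue.lean, one line, 0 sorry): `adviceFreeQNC0Three_iff.mpr
(Theorems.adviceFreeQNC0Sep_of_hlfNotFAC0Mod 3 (hB (hL hP hG)))` — the
residual Lift applied to PolyLoss3 and G gives T* = MultiRingHard3, ProductDial's PROVED bridge
gives HLFNotFAC0Mod 3, and the landed
`Theorems.adviceFreeQNC0Sep_of_hlfNotFAC0Mod` with `adviceFreeQNC0Three_iff` concludes the leaf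
F-Q1-p3. Binders consumed 4/4 (open cruxes
PolyLoss3, GlobalPencilHard3, GlobalPencilLift3; support MultiRingBridge3 PROVED in the ProductDial
node); the refines-glue G → Lift → DPLift3 is
definitional currying (`dpLift3_of_lift`, no item). Writer sketch sk/PencilDialSketch.lean: 4
Iff.rfl vs ProductDial tree decls, E_pres
`globalPencilHard3_iff_node` / `globalPencilLift3_iff_node` / `globalPencilHardUpToN_iff_node`
PROVED, rung-from-26123, necessity T* ⟹ G, closes; rc0 · 0 sorry.

CLOSES_TARGET: closes rung F-Q1-p3 of QuantumAdvantage: Summit.QuantumAdvantage.AdviceFreeQNC0.AdviceFreeQNC0Three (D-0061; not the summit Statement) — the deciding theorem of this route concludes that registered leaf instead of the Statement decl `QuantumAdvantage` (class rung: servable and labelled, never counted as concluding the summit Statement).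

Rationale: WHY THIS LINE. The multi-ring residual 26124 had no typed foothold: the node's first peel (resolving
pencils, NoResolvingPencil3) COLLAPSED to 26123
by a certified Iff (the victim ring steers itself, `nar_of_polyLoss3`, census LAW F5: peels by
polylog-LABELLED exact obstructions
collapse; only RESTRICTIONS of T* to strategy classes carry content), and the surviving restriction
is the smallest natural class with
genuine cross-ring dependence — pairwise-additive (foreign-order-1) cross-talk through an
𝔽₃-register. Its rank dial is theorem-backed
at the low end (R ≤ n: union bound over 3^R register values × the product bound for self-steered
sections, `registerDP3`, θ = 1/2,
K = k+2) and the critic's E-check shows where the union-bound road ENDS (rank n^{cK log n}: the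
total register pins the input SET by
multilinear Reed–Muller dual distance), naming the attack beyond: KERNEL NOISE — for fixed x, Σ_{j'}
K(X_{j'}, x) over m−1 i.i.d. rings is
2^−Ω(m)-close to uniform on 𝔽₃ unless K(·,x) is constant (ℤ₃ has no proper subgroup; node v2 §IV
translation lemma `translation_count_le`,
`gp_translation_bound` PROVED in the abstract). Imported areas: direct-product / XOR lemmas
(Viola–Wigderson doi:10.4086/toc.2008.v004a007,
Impagliazzo doi:10.1109/SFCS.1995.492584), the polynomial method over two moduli (Smolensky
doi:10.1145/28395.28404), discrete Fourier
uncertainty on 𝔽₃^R (tree Literature.Analysis.Fourier.DiscreteCantorFUP), the BGK ring game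
(arXiv:1704.00690 §4; WKST arXiv:1906.08890; GK arXiv:2408.16406).

RANKED CRUXES. #0 DPLift3 (target) — T = ProductDial's declared residual stmt-QuantumAdvantage-26124
(body VERBATIM, shared item; rank-0 record here): PolyLoss3 → MultiRingHard3. REFINED here as G ∧
Lift (Lift ≡ T mod G by currying, both directions PROVED). [deps: GlobalPencilHard3,
GlobalPencilLift3] [difficulty: open-problem] (why it might fail: XOR/direct-product lemmas for
polylog-degree 𝔽₃ polynomials against a RELATION are not in print; a joint strategy correlating
rings through shared registers could beat the product bound (global pencils are the first such class
and are NOT known to).) [doi:10.4086/toc.2008.v004a007, arXiv:1704.00690]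
#2 GlobalPencilHard3 (crux) — G (the OPEN END of the rank dial; NECESSARY for T*, PROVED; WEAKER
than T* structurally — members are AFFINE in the foreign register with polylog-degree
x-coefficients): some K and θ < 1 such that at every polylog degree, for all large n and EVERY rank
R, every global pencil (A, B, γ, s) wins ALL n^K rings on at most θ·2^(n^K·n) input tuples. PROVED
for R ≤ n given 26123 (aside GlobalPencilHardUpToN); beyond rank n^(cK·log n) the union-bound road
is closed (register pins the input set) and the attack is kernel noise (node v2 §IV). INSTRUMENTABLE
(census GP-2: aligned affine cross-reading rules at rank > n). [difficulty: L] (why it might fail: a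
high-rank global pencil whose x-DEPENDENT register directions B_r correlate the rings enough to win
all of them w.p. bounded below — the regime R > n^(K−k−1) where neither the union bound nor (yet)
the translation lemma applies.) [doi:10.4086/toc.2008.v004a007, doi:10.1109/SFCS.1995.492584,
arXiv:1704.00690]
#3 GlobalPencilLift3 (crux) — Lift (DECLARED RESIDUAL · NO-SHRINK ≡ DPLift3 mod G, both directions
PROVED by currying): the direct product GIVEN its value on global pencils — PolyLoss3 →
GlobalPencilHard3 → MultiRingHard3. IDEA-NEEDED (general polylog cross-dependence = foreign order up
to (log₂ n)^c; global pencils are foreign order 1). [deps: GlobalPencilHard3] [difficulty: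
open-problem] (why it might fail: exactly as DPLift3 fails outside the pencil class: higher
foreign-order cross-talk (a degree-D joint monomial touches ≤ D rings) with no product theorem for
relations at polylog degree.) [doi:10.4086/toc.2008.v004a007, arXiv:1704.00690]
#4 PolyLoss3 (crux) — ProductDial's crux stmt-QuantumAdvantage-26123 (body VERBATIM, shared item,
staffed there and partitioned by FormsDichotomy): one k such that at every polylog degree every 𝔽₃
strategy wins the one-ring game on at most (1 − n^−k)·2ⁿ patterns. Load-bearing binder of `closes`
here (the lift consumes it). [difficulty: open-problem] (why it might fail: a polylog-degree family
winning 1 − n^−ω(1) (none known; every census family is few-forms and loses polynomially).)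
[arXiv:1704.00690, doi:10.1145/28395.28404, arXiv:2408.16406]
#9 MultiRingBridge3 (support) — ProductDial's bridge stmt-QuantumAdvantage-26125 (body VERBATIM,
shared, PROVED in the ProductDial node): MultiRingHard3 → HLFNotFAC0Mod 3. [deps: MultiRingHard3]
[difficulty: S] [arXiv:1704.00690, doi:10.1145/28395.28404]
#9 MultiRingHard3 (support) — ProductDial's target T* stmt-QuantumAdvantage-26122 (body VERBATIM,
shared record; needed by DPLift3 / GlobalPencilLift3 / MultiRingBridge3 by name). [difficulty:
open-problem] [arXiv:1704.00690]
#9 GlobalPencilHardUpToN (support) — aside — the PROVED RANGE of the rank dial (node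
`globalPencilHardUpTo_n` from `registerDP3`: θ = 1/2, K = k+2, every joint strategy factoring
through ≤ n arbitrary 𝔽₃ registers), CONDITIONAL on 26123 (`PolyLoss3 → GlobalPencilHardUpToN`
PROVED, writer sketch `globalPencilHardUpToN_of_polyLoss3`): G restricted to ranks R ≤ n. Record of
the dial, not a binder. [deps: PolyLoss3] [difficulty: S] [arXiv:1704.00690,
doi:10.4086/toc.2008.v004a007]

TWO-LAYER PLAN. GlobalPencilHard3 ⇐ stub_lowRank (ranks R ≤ n^(K−k−1): union bound over register
values, the proved road extended — ATTACKABLE) ∧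
stub_kernelNoise (ranks beyond: the translation lemma «Σ_j' K(X_j', x) is 2^−Ω(m)-close to uniform
unless K(·,x) is constant» reduces each
ring to deterministic part + shared noise — IDEA-NEEDED but typed; node v2 §IV proves the abstract
translation count) — BC3 skeleton
bc-pc/GlobalPencilHard3_birth.lean. GlobalPencilLift3 is the declared residual (no decomposition
filed).

KILL CRITERIA. A global pencil family of some rank winning all n^K rings w.p. ≥ θ₀ > 0 for every K
refutes G and with it T* = MultiRingHard3 (26122) and
RingHardOdd 3 (kill path typed in the node: ¬G ⇒ ¬T* ⇒ ¬RingHardOdd 3) — close --reason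
refuted:GlobalPencilHard3 and flag ProductDial.
Census GP-2/GP-3 (x-dependent pencil directions at rank > n) are the early-warning instruments.

NOT DECOMPOSED YET. Lift stays whole (residual by design: foreign order 2 … (log₂ n)^c). G's two
regimes are typed as a skeleton, not as route children.

CHEAPEST FALSIFIER. Census GP-2 (kit minutes, lens instrument): exhaustive/heuristic search of
rank-(n+1…2n) global pencils with x-DEPENDENT directions B_r
for n ≤ 10, K = 1 (two to four rings): any family winning all rings w.p. not decaying in the number
of rings is a refutation signal for
G; inside rank ≤ n the census M1 already shows product behaviour (0 cross-reading rules beat the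
product, n = 8, 10). Not run by the writer (kit_allowed = false).

NUMBERS. Proved range: R ≤ n, θ = 1/2, K = k + 2, n ≥ max n₀ 4, degree 2(log₂ n)^c ≤ (log₂ n)^(c+1)
(registerDP3 / globalPencilHardUpTo_n).
Union-bound ceiling: rank n^(cK·log₂ n) (register = all multilinear monomials of degree ≤ ⌈K log₂ n⌉
+ 1 pins the input set; RM dual distance).
Translation lemma (node v2 §IV): count bound `translation_count_le`, `gp_translation_bound`
(abstract form PROVED).

DEFINITION REQUESTS. None: G is stated in EVALUATED form over tree constants
(`Smolensky.CubeFn/lowDeg`, `RingHLF.Rel`, Finset sums over 𝔽₃); the node's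
bookkeeping defs (flat/slice/globalPencil/winAllSet) are eliminated by `globalPencil_flat` (E_pres
proved in the sketch).

Novelty: Searches (lens g4 + writer, 2026-08-30): tree `rg 'direct product|XOR lemma|JointStrategy|pencil'
Summits/QuantumAdvantage Literature` (hits: ProductDial's MultiRingHard3/DPLift3 only; no
class-restricted multi-ring statement); `lit search --hybrid "XOR lemma direct product low degree
polynomials over F_3 relation"` → [corpus: Viola–Wigderson ToC 2008 doi:10.4086/toc.2008.v004a007
§4] (XOR lemma for GF(2) polynomials via Gowers norms, degree ≪ log n), [corpus: Impagliazzo FOCS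
1995 doi:10.1109/SFCS.1995.492584] (hard-core sets); `lit galaxy search "direct product theorem|XOR
lemma|parallel repetition" --star all` → [galaxy:pdf: Raz parallel repetition; Shaltiel derandomized
XOR] — none for relations vs polylog-degree 𝔽_p maps; no hits for "global pencil|shared
register|affine in register" in corpus (fts+vec) and galaxy.
Nearest prior art found: in tree, ProductDial:26124 (the target) and its proved product bound for
PRODUCT strategies (R = 0); FormsDichotomy (one-ring partition, different axis); in print,
Viola–Wigderson XOR lemmas for low-degree polynomials (functions, degree ≪ log n) and Bogdanov–Viola
sums of d PRGs — no statement about joint polynomial strategies for many copies of a relation.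
Delta: the first typed restriction of the p = 3 direct-product residual to a strategy CLASS with
genuine cross-ring dependence (affine in a shared 𝔽₃-register of foreign polylog-degree features),
necessary for T*, with the rank dial proved up to n registers and the end of the union-  [refs: 10.4086/toc.2008.v004a007, 10.1109/SFCS.1995.492584, doi:10.4086/toc.2008.v004a007, doi:10.1109/SFCS.1995.492584]

Barriers (technique_class: polynomial-method, direct-product, two-moduli, fourier): - technique_class: polynomial-method, direct-product, two-moduli, fourier
- Literature.Barriers.QuantumAdvantage.NonclassicalDegreeLogBarrier: does not bite the proved range
(union bound + product bound for self-steered sections, no derivative step); it caps Gowers-norm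
XOR-lemma transplants (Viola–Wigderson) at degree ≪ log n, which is why Lift is a declared residual
and G's high-rank regime is attacked by register translation, not by derivatives.
- Literature.Barriers.QuantumAdvantage.TwoModuliDepthTwo: EVADED — the statements USE the prescribed
MOD₃ structure (the register is an explicit 𝔽₃-vector of polynomial features; the translation lemma
is a statement about sums in ℤ₃ over independent rings), relational and average-case over input
tuples; a test-oblivious dense-case argument would be inside the class, and none is proposed.
- Literature.Barriers.QuantumAdvantage.TotalFunctionSpeedupLimit: not in play — the ring game is a
RELATION with many correct outputs and an average-case measure over patterns/tuples (evasions 2–5 of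
the audited entry); no query-complexity step.
- Literature.Barriers.QuantumAdvantage.NaturalProofs: not in play — explicit polylog-degree 𝔽₃
polynomial maps vs an explicit relation; no P/poly argument.
- Literature.Barriers.QuantumAdvantage.Algebrization: not in play — no oracles; white-box polynomial
method.
- Literature.Barriers.QuantumAdvantage.PromiseLiftRelativization: not in play — rung currency, no
promise lift.
- Literature.Barriers.QuantumAdva

sub-problem: QuantumAdvantage · status: draft · opened planner-decomp-qadv-writer-1-g2-0 2026-08-30T05:20:49Z · rev 1 · ledger route-QuantumAdvantage-PencilDial
GENERATED by the gate from the ledger (D-0016/17). Provers cite these decls: `theorem foo : Summit.QuantumAdvantage.QuantumAdvantage.Theses.PencilDial.<Decl> := …` in Summits/QuantumAdvantage/QuantumAdvantage/Theorems/<Name>.lean.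
-/

namespace Summit.QuantumAdvantage.QuantumAdvantage.Theses.PencilDial

open scoped BigOperators Topology Manifold Classical MeasureTheory ProbabilityTheory Matrix InnerProductSpace ComplexConjugate ContinuousMap
open Filter Set Function TopologicalSpace MeasureTheory

attribute [summit_statement] _root_.QuantumAdvantage
attribute [summit_statement] _root_.Summit.QuantumAdvantage.AdviceFreeQNC0.AdviceFreeQNC0Three

open Literature.QuantumAdvantage

/-- item stmt-QuantumAdvantage-28430 · crux · rank 2 · open · by planner
why it might fail: a high-rank global pencil whose x-DEPENDENT register directions B_r correlate the rings enough to win all of them w.p. bounded below — the regime R > n^(K−k−1) where neither the union bound nor (yet) the translation lemma applies.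
sources: doi:10.4086/toc.2008.v004a007, doi:10.1109/SFCS.1995.492584, arXiv:1704.00690
[crux] G (the OPEN END of the rank dial; NECESSARY for T*, PROVED; WEAKER than T* structurally —
members are AFFINE in the foreign register with polylog-degree x-coefficients): some K and θ < 1
such that at every polylog degree, for all large n and EVERY rank R, every global pencil (A, B, γ,
s) wins ALL n^K rings on at most θ·2^(n^K·n) input tuples. PROVED for R ≤ n given 26123 (aside
GlobalPencilHardUpToN); beyond rank n^(cK·log n) the union-bound road is closed (register pins the
input set) and the attack is kernel noise (node v2 §IV). INSTRUMENTABLE (census GP-2: aligned affine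
cross-reading rules at rank > n). [difficulty: L] -/
@[route_item "route-QuantumAdvantage-PencilDial", crux (bottleneck := work) (source := "ledger D-0171 leaf tag ATTACKABLE on stmt-QuantumAdvantage-28430, 2026-09-01")]
def GlobalPencilHard3 : Prop :=
  ∃ K : ℕ, ∃ θ : ℝ, θ < 1 ∧ ∀ c : ℕ, ∃ n₀ : ℕ, ∀ n ≥ n₀, ∀ R : ℕ, ∀ (A : Fin n → Literature.Computability.MetaComplexity.Smolensky.CubeFn (ZMod 3) n) (B : Fin R → Fin n → Literature.Computability.MetaComplexity.Smolensky.CubeFn (ZMod 3) n) (γ : Fin R → Literature.Computability.MetaComplexity.Smolensky.CubeFn (ZMod 3) n) (s : Fin R → ZMod 3), (∀ i, A i ∈ Literature.Computability.MetaComplexity.Smolensky.lowDeg (ZMod 3) n ((Nat.log 2 n) ^ c)) → (∀ r i, B r i ∈ Literature.Computability.MetaComplexity.Smolensky.lowDeg (ZMod 3) n ((Nat.log 2 n) ^ c)) → (∀ r, γ r ∈ Literature.Computability.MetaComplexity.Smolensky.lowDeg (ZMod 3) n ((Nat.log 2 n) ^ c)) → ((Finset.univ.filter fun X : Fin (n ^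 K) → Fin n → Bool => ∀ j, Literature.Computability.QuantumComplexity.RingHLF.Rel (X j) (fun i => decide (A i (X j) + ∑ r, (s r + ∑ j' ∈ Finset.univ.erase j, γ r (X j')) * B r i (X j) = 1))).card : ℝ) ≤ θ * (2 : ℝ) ^ (n ^ K * n)

/-- item stmt-QuantumAdvantage-26123 · crux · rank 4 · open · by planner
why it might fail: a polylog-degree family winning 1 − n^−ω(1) (none known; every census family is few-forms and loses polynomially).
sources: arXiv:1704.00690, doi:10.1145/28395.28404, arXiv:2408.16406
[crux] inverse-polynomial single-ring loss at every polylog degree: some k such that for every c,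
for all large n, every single-ring 𝔽₃-strategy (z_i = [P_i(x) = 1], deg P_i ≤ (log₂ n)^c) satisfies
the n-cycle relation RingHLF.Rel on at most (1 − n^(−k))·2^n of ALL 2^n inputs (plain count).
Strictly weaker than T (T ⇒ PolyLoss3, `polyLoss3_of_ringHardOdd`) and than AffineCore3's
constant-loss demand; degree-1 slice PROVED (`polyLossOne3`, from the tree's
AffBells37.affBellsPolyLoss3). [difficulty: L] -/
@[route_item "route-QuantumAdvantage-PencilDial", crux]
def PolyLoss3 : Prop :=
  ∃ k : ℕ, ∀ c : ℕ, ∃ n₀ : ℕ, ∀ n ≥ n₀, ∀ P : Fin n → Literature.Computability.MetaComplexity.Smolensky.CubeFn (ZMod 3) n, (∀ i, P i ∈ Literature.Computability.MetaComplexity.Smolensky.lowDeg (ZMod 3) n ((Nat.log 2 n) ^ c)) → ((Finset.univ.filter fun x : Fin n → Bool => Literature.Computability.QuantumComplexity.RingHLF.Rel x (fun i => decide (P i x = 1))).card : ℝ) ≤ (1 - 1 / (n : ℝ) ^ k) * (2 : ℝ) ^ n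

/-- item stmt-QuantumAdvantage-26122 · support · rank 9 · open · by planner
sources: arXiv:1704.00690
[target] T* (the reformulated target, rank 0; assembly conclusion of layer 2): there are K and θ < 1
such that for every c, for all large n, every joint strategy for n^K rings of length n whose outputs
are 𝔽₃-polynomials of degree ≤ (log₂ n)^c in all n^K·n input bits wins all rings (each ring's output
satisfies RingHLF.Rel) on at most θ·2^(n^K·n) input tuples. T → T* proved (node file
`multiRingHard3_of_ringHardOdd`); T* → PolyLoss3 proved (`polyLoss3_of_multiRingHard3`). [deps:
PolyLoss3, DPLift3] [difficulty: open-problem] -/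
@[route_item "route-QuantumAdvantage-PencilDial"]
def MultiRingHard3 : Prop :=
  ∃ K : ℕ, ∃ θ : ℝ, θ < 1 ∧ ∀ c : ℕ, ∃ n₀ : ℕ, ∀ n ≥ n₀, ∀ P : Fin (n ^ K) → Fin n → Literature.Computability.MetaComplexity.Smolensky.CubeFn (ZMod 3) (n ^ K * n), (∀ j i, P j i ∈ Literature.Computability.MetaComplexity.Smolensky.lowDeg (ZMod 3) (n ^ K * n) ((Nat.log 2 n) ^ c)) → ((Finset.univ.filter fun X : Fin (n ^ K) → Fin n → Bool => ∀ j, Literature.Computability.QuantumComplexity.RingHLF.Rel (X j) (fun i => decide (P j i (fun k => X (finProdFinEquiv.symm k).1 (finProdFinEquiv.symm k).2) = 1))).card : ℝ) ≤ θ * (2 : ℝ) ^ (n ^ K * n)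

/-- item stmt-QuantumAdvantage-28431 · crux · rank 3 · open · by planner
why it might fail: exactly as DPLift3 fails outside the pencil class: higher foreign-order cross-talk (a degree-D joint monomial touches ≤ D rings) with no product theorem for relations at polylog degree.
sources: doi:10.4086/toc.2008.v004a007, arXiv:1704.00690
[crux] Lift (DECLARED RESIDUAL · NO-SHRINK ≡ DPLift3 mod G, both directions PROVED by currying): the
direct product GIVEN its value on global pencils — PolyLoss3 → GlobalPencilHard3 → MultiRingHard3.
IDEA-NEEDED (general polylog cross-dependence = foreign order up to (log₂ n)^c; global pencils are
foreign order 1). [deps: GlobalPencilHard3] [difficulty: open-problem] -/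
@[route_item "route-QuantumAdvantage-PencilDial", crux (bottleneck := idea) (source := "ledger wanted_by.residual on stmt-QuantumAdvantage-28431, 2026-09-01")]
def GlobalPencilLift3 : Prop :=
  PolyLoss3 → GlobalPencilHard3 → MultiRingHard3

/-- item stmt-QuantumAdvantage-26124 · aside · rank 0 · open · by planner
why it might fail: XOR/direct-product lemmas for polylog-degree 𝔽₃ polynomials against a RELATION are not in print; a joint strategy correlating rings through shared registers could beat the product bound (global pencils are the first such class and are NOT known to).
sources: doi:10.4086/toc.2008.v004a007, arXiv:1704.00690
[crux] DECLARED-RESIDUAL (NO-SHRINK piece, critic row 9): the direct-product lift PolyLoss3 →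
MultiRingHard3 — an inverse-polynomial loss per ring at every polylog degree amplifies, over n^K
disjoint rings read JOINTLY, to a constant all-rings bound. Proved special cases in the node file:
separable strategies (`dpSeparable3`) and triangular/causal reading orders (`dpTriangular3`,
induction over rings via `card_winAllSet_triangular_le`); the symmetric cross-reading case is the
open content; constant-degree sub-rung DPLiftConst3 filed as aside. [deps: PolyLoss3] [difficulty:
open-problem] -/
@[route_item "route-QuantumAdvantage-PencilDial"]
def DPLift3 : Prop :=
  PolyLoss3 → MultiRingHard3

/-- item stmt-QuantumAdvantage-26125 · support · rank 9 · closed · proved by Summit.QuantumAdvantage.QuantumAdvantage.Theorems.pencilDial_multiRingBridge3 (prover) · by planner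
sources: arXiv:1704.00690, doi:10.1145/28395.28404
[support] LOAD-BEARING support (binder of `closes`; critic: staff/land FIRST): T* feeds the
registered leaf hypothesis — MultiRingHard3 → HLFNotFAC0Mod 3: restrict N×N 2D-HLF circuits over
accBasis 3 to instances carrying n^K disjoint square cycles of length n, turn the FAC⁰[3] circuit
tuple into ONE joint polylog-degree 𝔽₃-strategy for all rings at once by the relational
Razborov–Smolensky lemma (tree `Smolensky.exists_uniformProb_le`, error counted once for the whole
tuple), transfer HLF solutions to ring wins ring by ring (tree `GridCycle.rel_of_mem_hlfSolutions`),
exactly as the single-ring bridge `Theorems.hlfNotFAC0Mod_of_ringHard8` (RingFrameBridge.lean:119)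
with the packing of n^K cycles replacing one 8t-cycle. [difficulty: M] STATUS 2026-08-30 (record
correction): PROVED in a LAND-READY file — BridgeDial (lens-5 g6) Theorems/MultiRingBridge.lean
sha256 d782ca8a… (832 l, farm rc0 · 0 sorry): `Theorems.productDial_multiRingBridge3 :
ProductDial.MultiRingBridge3` (this shared decl — closes the item in all six routes) and
`adviceFreeQNC0Three_of_multiRingHard3 : MultiRingHard3 → AdviceFreeQNC0Three`; attached as evidence
on this item; LAND FIRST `ledger propose --kind proof -- -/
@[route_item "route-QuantumAdvantage-PencilDial", crux]
def MultiRingBridge3 : Prop :=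
  MultiRingHard3 → Summit.QuantumAdvantage.AdviceFreeQNC0.HLFNotFAC0Mod 3

-- `MultiRingBridge3` holds: proved by `Summit.QuantumAdvantage.QuantumAdvantage.Theorems.pencilDial_multiRingBridge3` (its module imports this route file, so no `_holds` link can be stated here).

/-- item stmt-QuantumAdvantage-28432 · aside · rank 9 · open · by planner
sources: arXiv:1704.00690, doi:10.4086/toc.2008.v004a007
[support] aside — the PROVED RANGE of the rank dial (node `globalPencilHardUpTo_n` from
`registerDP3`: θ = 1/2, K = k+2, every joint strategy factoring through ≤ n arbitrary 𝔽₃ registers),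
CONDITIONAL on 26123 (`PolyLoss3 → GlobalPencilHardUpToN` PROVED, writer sketch
`globalPencilHardUpToN_of_polyLoss3`): G restricted to ranks R ≤ n. Record of the dial, not a
binder. [deps: PolyLoss3] [difficulty: S] -/
@[route_item "route-QuantumAdvantage-PencilDial"]
def GlobalPencilHardUpToN : Prop :=
  ∃ K : ℕ, ∃ θ : ℝ, θ < 1 ∧ ∀ c : ℕ, ∃ n₀ : ℕ, ∀ n ≥ n₀, ∀ R : ℕ, R ≤ n → ∀ (A : Fin n → Literature.Computability.MetaComplexity.Smolensky.CubeFn (ZMod 3) n) (B : Fin R → Fin n → Literature.Computability.MetaComplexity.Smolensky.CubeFn (ZMod 3) n) (γ : Fin R → Literature.Computability.MetaComplexity.Smolensky.CubeFn (ZMod 3) n) (s : Fin R → ZMod 3), (∀ i, A i ∈ Literature.Computability.MetaComplexity.Smolensky.lowDeg (ZMod 3) n ((Nat.log 2 n) ^ c)) → (∀ r i, B r i ∈ Literature.Computability.MetaComplexity.Smolensky.lowDeg (ZMod 3) n ((Nat.log 2 n) ^ c)) → (∀ r, γ r ∈ Literature.Computability.MetaComplexity.Smolensky.lowDeg (ZMod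 3) n ((Nat.log 2 n) ^ c)) → ((Finset.univ.filter fun X : Fin (n ^ K) → Fin n → Bool => ∀ j, Literature.Computability.QuantumComplexity.RingHLF.Rel (X j) (fun i => decide (A i (X j) + ∑ r, (s r + ∑ j' ∈ Finset.univ.erase j, γ r (X j')) * B r i (X j) = 1))).card : ℝ) ≤ θ * (2 : ℝ) ^ (n ^ K * n)

/-- item stmt-QuantumAdvantage-28433 · assembly · rank 1 · open · by planner
sources: arXiv:1704.00690
[assembly] PolyLoss3 → GlobalPencilHard3 → GlobalPencilLift3 → MultiRingBridge3 →
AdviceFreeQNC0Three (`assembly_holds := closes`). -/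
@[route_item "route-QuantumAdvantage-PencilDial"]
def Assembly : Prop :=
  PolyLoss3 → GlobalPencilHard3 → GlobalPencilLift3 → MultiRingBridge3 → Summit.QuantumAdvantage.AdviceFreeQNC0.AdviceFreeQNC0Three

/-! D-0027 §2.1 — DECIDING THEOREM (planner-authored via `route open/edit --closes-file`; by planner-decomp-qadv-writer-1-g2-0 2026-08-30T05:20:49Z):
its hypotheses are this route's items and its conclusion the registered leaf `Summit.QuantumAdvantage.AdviceFreeQNC0.AdviceFreeQNC0Three` (rung F-Q1-p3, D-0061) (glue_lint), and it elaborates with this file. -/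

/-- Deciding theorem of route PencilDial (decomp-qadv lens 5 gen 4, SHAPE B at F-Q1-p3): the declared residual `GlobalPencilLift3`
applied to ProductDial's crux `PolyLoss3` and the global-pencil crux `GlobalPencilHard3` gives T* = `MultiRingHard3`; ProductDial's proved
bridge `MultiRingBridge3` gives `HLFNotFAC0Mod 3`, and the landed `Theorems.adviceFreeQNC0Sep_of_hlfNotFAC0Mod` with
`adviceFreeQNC0Three_iff` concludes the rung leaf F-Q1-p3 (the refines-glue G → Lift → DPLift3 is definitional currying). -/
@[closes "route-QuantumAdvantage-PencilDial"] theorem closes (hP : PolyLoss3) (hG : GlobalPencilHard3) (hL : GlobalPencilLift3) (hB : MultiRingBridge3) :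
    Summit.QuantumAdvantage.AdviceFreeQNC0.AdviceFreeQNC0Three :=
  Summit.QuantumAdvantage.AdviceFreeQNC0.adviceFreeQNC0Three_iff.mpr
    (Summit.QuantumAdvantage.QuantumAdvantage.Theorems.adviceFreeQNC0Sep_of_hlfNotFAC0Mod 3 (hB (hL hP hG)))

end Summit.QuantumAdvantage.QuantumAdvantage.Theses.PencilDial
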